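import Summits.BirchSwinnertonDyer.BirchSwinnertonDyer.Theses.AdditiveKolyvaginRoad
import Summits.BirchSwinnertonDyer.BirchSwinnertonDyer.Theorems.AdditiveKolyvaginRoadLevelSystemsOfSeedCruxFree
import Summits.BirchSwinnertonDyer.BirchSwinnertonDyer.Theorems.AdditiveKolyvaginRoadEigen
import Summits.BirchSwinnertonDyer.BirchSwinnertonDyer.Theorems.AdditiveKolyvaginRoadBottomRankOneAdditiveNonTorsion
import Summits.BirchSwinnertonDyer.BirchSwinnertonDyer.Theorems.AdditiveKolyvaginRoadBottomRankOneAdditiveOfPrimitive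
import Summits.BirchSwinnertonDyer.BirchSwinnertonDyer.Theorems.AdditiveKolyvaginRoadKolyvaginPrimitiveOfIndexLowerBoundConverse
import Summits.BirchSwinnertonDyer.Rank1Residual.X11b.UnitSaturationCertificate
import Summits.BirchSwinnertonDyer.Rank1Residual.X11b.BDPRouteOnTreeStepL
import Literature.NumberTheory.EllipticCurves.KolyvaginShaIndexBound
import Literature.NumberTheory.EllipticCurves.HeegnerPointFiniteIndex

/-! # LevelKolyvaginSystemsAdditive — line `bdp-rebase`, skeleton v4 (= v3 of crux-plan g3 with S5 RE-TYPED in X11b's `hL` shape; width seat akr-p2x-w2 g5, 2026-08-28)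

Crux item `stmt-BirchSwinnertonDyer-21396` (KS′) of route `AdditiveKolyvaginRoad`:
`Summit.BirchSwinnertonDyer.BirchSwinnertonDyer.Theses.AdditiveKolyvaginRoad.LevelKolyvaginSystemsAdditive`.

IDEA `bdp-rebase` (⊇ `fern-transport-bdp`; engine card `residual-bdp-transport`; TRIAGE-r1-1 §4 row S3, TRIAGE-r1-2 survivor B).
v3 = v2 with the bottom converse RE-CUT INTO ENGINE SHAPE. v2's stub S5 `stub_bottomConverseAdditive` («`rank_∅ ≤ 1 ⟹ c(1) ≠ 0`»,
no printed engine has that output shape) is replaced by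

* S5 `stub_indexLowerBoundAdditive` — THE HEEGNER-INDEX LOWER BOUND AT AN ADDITIVE PRIME: at every ♯ additive frame and every
  Heegner point `y_K ∈ E(K)` of infinite order, `X11b.IndexLowerBoundAt W p K y_K`, i.e.
  `2·ord_p [E(K) : ℤy_K] ≤ ord_p #Ш(E/K) + 2·ord_p ∏_ℓ c_ℓ(E)` — BY NAME the typed STEP L input of the sibling class X11b
  (`Summits/BirchSwinnertonDyer/Rank1Residual/X11b/BDPRoute.lean`, there at `p ∥ N`), here demanded at `p² ∣ N`. This is exactly the
  output shape of every printed BDP-side engine (Jetchev–Skinner–Wan 2017 (eq:shalowerK-1): anticyclotomic CONTROL + ONE main-conjecture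
  DIVISIBILITY `Ch_Λ(X_ac) ⊆ (L_p^BDP)` + the BDP ∕ `p`-adic Waldspurger formula; Castella 2018 (1.1) at `p ∣ N`), and of the crux's new
  engine card `Ideas/residual-bdp-transport.md` (C⁺ ⟹ `IndexLowerBoundAt`), and
* the PROVED reduction `kolyvaginClass_one_ne_zero_of_indexLowerBoundAt` (no `sorry`): on a frame with bottom total canonical rank
  `rank_∅ ≤ 1`, the lower bound forces `c(1) ≠ 0` for EVERY conductor-one Kolyvagin–Heegner datum — `y_K` is non-torsion
  (Gross–Zagier + modularity, PUB), so `rank E(K) = 1` and `Ш(E/K)` is finite (Kolyvagin, PUB); `#Sel_p = p^{rank_∅} ≤ p` against the exact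
  descent count `#Sel_p = p·#E(K)[p]·#Ш[p]` gives `Ш(E/K)[p] = 0`, hence `p ∤ #Ш(E/K)` (Cauchy); with `p ∤ ∏c_ℓ` the lower bound reads
  `ord_p [E(K) : ℤy_K] = 0`; but `y_K = pQ` would put an element of order `p` in `E(K)/ℤy_K`; so `y_K ∉ pE(K)`, i.e. `c(1) ≠ 0`
  (tree `kolyvaginClass_one_ne_zero_iff_not_exists_zsmul_eq`).

So v2's S5 is now S5(v3) ∘ (proved), and the composition is unchanged in shape:

* INDIVISIBLE LOCUS (every conductor-one datum has `c(1) ≠ 0`): K1's datum (S3, VERBATIM line `additive_fibre_ignition`'s K1) read at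
  `n₀ = ∅`, rank clause `rank_∅ = 1` by the PROVED Kolyvagin direction `finrank_selQP_empty_eq_one_of_kolyvaginClass_one_ne_zero` (v2).
* DIVISIBLE LOCUS (some datum has `c(1) = 0`): by S5 + the proved reduction the bottom total rank is `≥ 2`, and S4 (the HARDEST stub,
  unchanged) hands the level-raised datum-with-seed.

ONE STATEMENT, THREE CONSUMERS (recorded for the route's tenure planner; nothing here edits the route): S5 is (i) this line's bottom input;
(ii) with McCallum 1991 Cor. 5.6 (tree fact `McCallum1991_padicValNat_card_sha_primary_add_le_of_globalDivisibility`, t = 1) and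
Kolyvagin's bound it gives Kolyvagin's conjecture mod `p` at the additive prime (crux KPA′) WITHOUT level systems; (iii) with
`X11b.indexIdentityAt_of_lowerBound_of_kolyvagin` + `X11b.bsdp_of_indexIdentityAt` + the route's residual `RankZeroAdditive` for the twist it
gives `BSDp W p` on ♯ frames directly. See the line card `Lines/bdp-rebase.md` §Route-level offers.

SOCKET: `levelKolyvaginSystemsAdditive_of_seed_free` (p594553: KS′ ⟸ PUB ∧ DUAL ∧ datum-with-seed). `LevelKolyvaginSystemsAdditive_of` is
kernel-checked with NO `sorry` of its own; `sorry` occurs only in the five `stub_*`. CONDITIONAL skeleton; closes nothing; BSD is NOT proved by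
any of this; KS′, K1, S4 and S5 are OPEN mathematics.

v4 CHANGES (width seat `bsd-wall-akr-p2x-w2` g5, after TRIAGE-r1-1 v13 «stub-misstated: stub_indexLowerBoundAdditive»): (1) S5 is RE-TYPED
in X11b's `hL` SHAPE (b): its conclusion now quantifies over the FRAME's Heegner points — `∀ (H : HeegnerDatum N_E d_K) (P : E(K)),
H.β = β → P ↦ heegnerPointComplex Dt H under ι → P of infinite order → X11b.IndexLowerBoundAt W p K P` — instead of over
`IsHeegnerPoint N_E W K P` (∃ over ALL parametrisation data, which admits the scaled datum `m•φ` and makes the old S5 FALSE on every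
frame: triage witness `Scaling.lean`, evidence #59). The frame's `¬ p ∣ Dt.c` now binds the right datum. (2) The PROVED reduction
`kolyvaginClass_one_ne_zero_of_indexLowerBoundAt` takes the new shape (plus the orientation `hβ`, to produce `H` with `H.β = β` by
`exists_heegnerDatum`); its `y_K` is identified with the frame's Heegner point by Shimura reciprocity at conductor `1`
(`KolyvaginBottom.eq_of_map_eq_heegnerPointComplex`, proved); the rest of the proof is v3 VERBATIM. (3) The composition is unchanged but
for threading `hβ`. (4) ROUTE-LEVEL READING now KERNEL-CHECKED in the tree (not part of this skeleton): with S5 in this shape,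
`AdditiveKoly.kolyvaginPrimitiveAdditive_of_indexLowerBound` (p619900) gives crux r2 KPA′ from PUB ∧ McCallum's Cor. 5.6 divisibility half ∧
S5's statement, and `AdditiveKoly.kolyvaginPrimitiveAdditive_iff_indexLowerBound` (p620657) shows KPA′ ⟺ S5's statement modulo those
inputs (`kolyvaginPrimitiveAdditive_of_stubs` below displays the first). `lean check`: rc 0, sorries 5 = the five `stub_*` (S1 S2 by name,
S3 = K1, S4, S5 OPEN). NOT re-registered (the item's skeleton slot holds the lead's `epsilon_matched_retyping` v8 of record). BSD is NOT
proved by any of this. -/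
set_option linter.dupNamespace false

noncomputable section

open scoped Classical

open WeierstrassCurve NumberField IsDedekindDomain
  Literature.NumberTheory.EllipticCurves Literature.NumberTheory.EllipticCurves.ModularForms
  Literature.NumberTheory.EllipticCurves.Rank1Residual Literature.NumberTheory.GaloisRepresentations Module
  Summit.BirchSwinnertonDyer.Rank1Residual.X11b.Three.Koly
  Summit.BirchSwinnertonDyer.Rank1Residual.X11b.UnitSaturationCertificate
  Summit.BirchSwinnertonDyer.BirchSwinnertonDyer.Theses.AdditiveKolyvaginRoad
  Summit.BirchSwinnertonDyer.BirchSwinnertonDyer.Theorems.AdditiveKoly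

namespace Summit.BirchSwinnertonDyer.BirchSwinnertonDyer.Cruxes.LevelKolyvaginSystemsAdditive.BdpRebase

/-! ## The five registered stubs (S1 S2 by name · S3 = K1 · S4 level-raised seed · S5 index lower bound at additive `p`) -/

/-- stub S1 (BY NAME, route support item stmt-BirchSwinnertonDyer-20137, split gen 1): the route's displayed PUBLISHED INPUTS
(Gross–Zagier, Kolyvagin `rank = 1 ∧ Ш finite`, Kolyvagin's bound `ord_p #Ш ≤ 2 ord_p I_K`, GZK rank part, entire `L(E, s)`, the
newform of `E`, Hoffstein–Luo, McCallum's certificate, the conductor-one Galois-conjugation input). Conjuncts 2 and 3 are CONSUMED by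
the proved bottom row below. -/
theorem stub_publishedInputs : PublishedInputsAdditiveKoly := by
  sorry

/-- stub S2 (BY NAME, route support item stmt-BirchSwinnertonDyer-21333): the route's displayed DUALITY INPUTS (levelwise
Cassels–Tate ∕ Flach alternation and Poitou–Tate self-duality of the signed Selmer structures) — consumed by the socket. -/
theorem stub_publishedDuality : PublishedDualityInputsAdditiveKoly := by
  sorry

/-- stub S3 = K1 — THE GEOMETRIC BIPARTITE DATUM at `p²`-level (OPEN; the crux's core shared by every line). VERBATIM the statement
of `AdditiveFibreIgnition.stub_geometricBipartiteDatum` (same `Prop`: one proof closes both lines' K1). At a ♯ frame with `p ≥ 5`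
additive, for the Kolyvagin classes mod `p` of EVERY Kolyvagin conductor `∏ m` (row `realisation`): classes `κ₀ m n ∈ H¹(K, E[p])`
at every finite set `n` of admissible primes and values `lam m n ∈ 𝔽_p`, with — at every non-empty even level — E's Kummer
condition off `m ∪ n`, the TORIC condition on `n`, the TRANSVERSE condition on `m`, the relation (8.1); the sign under complex
conjugation at EVERY even level (`∅` included); and the Bertolini–Darmon ∕ Howard reciprocity laws (A)/(B) TWO-SIDED (detected-iff-unit
form; NO multiplicity-one axiom at `p²`-level is asserted). Printed for `p ∤ N` [cite: WZhang2014, §3–§4, (3.30), Thm. 4.3, Prop. 5.4]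
[cite: BertoliniDarmon2005, Thm. 4.1, Thm. 4.2] [cite: Howard2006Bipartite, Prop. 2.4.11, Thm. 2.5.1] [cite: GrossLMS1991, Prop. 5.4 (2),
6.2]; at `p² ∣ N` the level-raising-with-type and the character-group input behind the two-sided laws are NOT in print (DEAD-LINES
D1–D3). Why it might fail: multiplicity one on the `𝔪`-part at level `p²M∏n` fails off the EGS-generic locus ((5, II*) census), so the
values `lam` may need a covector carrier there. -/
theorem stub_geometricBipartiteDatum :
    PublishedInputsAdditiveKoly → PublishedDualityInputsAdditiveKoly →
    ∀ (W : WeierstrassCurve ℚ) [W.IsElliptic] [W.IsGloballyMinimal] [NeZero (W.conductorNorm ℤ)]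
      (p : ℕ) [Fact p.Prime] (K : Type) [Field K] [NumberField K]
      (Dt : ModularParametrizationData W (W.conductorNorm ℤ)) (β : ℤ) (ι : K →+* ℂ),
      5 ≤ p → Addv W p → W.HasSurjectiveModNGaloisRep p →
      (∀ (ℓ : ℕ) [Fact ℓ.Prime], W.HasMultiplicativeReductionAtPrime ℓ →
        ¬ p ∣ padicValInt ℓ W.minimalDiscriminantInt) →
      (∃ (ℓ₁ ℓ₂ : ℕ) (_ : Fact ℓ₁.Prime) (_ : Fact ℓ₂.Prime), ℓ₁ ≠ ℓ₂ ∧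
        W.HasMultiplicativeReductionAtPrime ℓ₁ ∧ W.HasMultiplicativeReductionAtPrime ℓ₂) →
      ¬ p ∣ W.tamagawaProduct → W.analyticRank = 1 →
      IsImaginaryQuadratic K → Odd (NumberField.discr K) → NumberField.discr K < -4 →
      SatisfiesHeegnerHypothesis (W.conductorNorm ℤ) K →
      (W.quadraticTwist (NumberField.discr K : ℚ)).entireLFunction 1 ≠ 0 →
      (4 * (W.conductorNorm ℤ : ℤ)) ∣ β ^ 2 - NumberField.discr K → ¬ (p : ℤ) ∣ Dt.c →
      ∀ (c : K ≃ₐ[ℚ] K), c ≠ 1 → ∀ [Module (ZMod p) (Vp W K p)],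
      ∃ (ε₀ : Finset (AdmQ W K p) → Bool)
        (κ₀ : Finset {ℓ // Zhang2014.IsKolyvaginPrime (W.conductorNorm ℤ) W K p ℓ} → Finset (AdmQ W K p) → Vp W K p)
        (lam : Finset {ℓ // Zhang2014.IsKolyvaginPrime (W.conductorNorm ℤ) W K p ℓ} → Finset (AdmQ W K p) → ZMod p),
        -- realisation at level `∅`: the classes ARE the frame's Kolyvagin classes mod `p`
        (∀ m : Finset {ℓ // Zhang2014.IsKolyvaginPrime (W.conductorNorm ℤ) W K p ℓ},
          ∃ d : KolyvaginHeegnerData Dt β ι (∏ ℓ ∈ m, (ℓ : ℕ)), κ₀ m ∅ = d.kolyvaginClass (Fact.out : p.Prime) 1) ∧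
        -- sign at EVERY even level, `∅` included (Gross Prop. 5.4 (2) at level `∅`; the socket's row is the `n.Nonempty` restriction)
        (∀ n : Finset (AdmQ W K p), Even n.card →
          ∀ m : Finset {ℓ // Zhang2014.IsKolyvaginPrime (W.conductorNorm ℤ) W K p ℓ},
          conjAct W c ((p ^ 1 : ℕ) : ℤ) (κ₀ m n) = sgnP (ε₀ n ^^ Nat.bodd m.card) • κ₀ m n) ∧
        -- selmer_off
        (∀ n : Finset (AdmQ W K p), n.Nonempty → Even n.card →
          ∀ (m : Finset {ℓ // Zhang2014.IsKolyvaginPrime (W.conductorNorm ℤ) W K p ℓ}) (v : HeightOneSpectrum (𝓞 K)),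
          (∀ ℓ ∈ m, ((ℓ : ℕ) : 𝓞 K) ∉ v.asIdeal) → (∀ q ∈ n, ((q : ℕ) : 𝓞 K) ∉ v.asIdeal) →
          κ₀ m n ∈ selmerLocalKer (W.baseChange K) (v.adicCompletion K) ((p ^ 1 : ℕ) : ℤ)) ∧
        -- selmer_inf
        (∀ n : Finset (AdmQ W K p), n.Nonempty → Even n.card →
          ∀ (m : Finset {ℓ // Zhang2014.IsKolyvaginPrime (W.conductorNorm ℤ) W K p ℓ}) (w : InfinitePlace K),
          κ₀ m n ∈ selmerLocalKer (W.baseChange K) w.Completion ((p ^ 1 : ℕ) : ℤ)) ∧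
        -- toric_on
        (∀ n : Finset (AdmQ W K p), n.Nonempty → Even n.card →
          ∀ m : Finset {ℓ // Zhang2014.IsKolyvaginPrime (W.conductorNorm ℤ) W K p ℓ}, ∀ q ∈ n,
          ∀ v : HeightOneSpectrum (𝓞 K), ((q : ℕ) : 𝓞 K) ∈ v.asIdeal →
          κ₀ m n ∈ toricLocalKer (W.baseChange K) (v.adicCompletion K) ((p ^ 1 : ℕ) : ℤ)) ∧
        -- transverse_on
        (∀ n : Finset (AdmQ W K p), n.Nonempty → Even n.card →
          ∀ m : Finset {ℓ // Zhang2014.IsKolyvaginPrime (W.conductorNorm ℤ) W K p ℓ}, ∀ ℓ ∈ m,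
          ∀ v : HeightOneSpectrum (𝓞 K), ((ℓ : ℕ) : 𝓞 K) ∈ v.asIdeal → κ₀ m n ∈ transverseLocalKerP W K p ι ℓ v) ∧
        -- relation (8.1)
        (∀ n : Finset (AdmQ W K p), n.Nonempty → Even n.card →
          ∀ (m : Finset {ℓ // Zhang2014.IsKolyvaginPrime (W.conductorNorm ℤ) W K p ℓ})
            (ℓ : {ℓ // Zhang2014.IsKolyvaginPrime (W.conductorNorm ℤ) W K p ℓ}), ℓ ∉ m →
          ∀ v : HeightOneSpectrum (𝓞 K), ((ℓ : ℕ) : 𝓞 K) ∈ v.asIdeal →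
          (κ₀ (insert ℓ m) n ∈ (W.baseChange K).torsionLocalKer (v.adicCompletion K) ((p ^ 1 : ℕ) : ℤ) ↔
            κ₀ m n ∈ (W.baseChange K).torsionLocalKer (v.adicCompletion K) ((p ^ 1 : ℕ) : ℤ))) ∧
        -- law (A), TWO-SIDED: the value one level up is a unit iff the class is detected at the NEW prime
        (∀ (n : Finset (AdmQ W K p)) (q : AdmQ W K p), Even n.card → q ∉ n →
          ∀ m : Finset {ℓ // Zhang2014.IsKolyvaginPrime (W.conductorNorm ℤ) W K p ℓ},
          lam m (insert q n) ≠ 0 ↔ ∃ v : HeightOneSpectrum (𝓞 K), ((q : ℕ) : 𝓞 K) ∈ v.asIdeal ∧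
            κ₀ m n ∉ (W.baseChange K).torsionLocalKer (v.adicCompletion K) ((p ^ 1 : ℕ) : ℤ)) ∧
        -- law (B), TWO-SIDED: the class is detected at a LEVEL prime iff the value one level down is a unit
        (∀ (n : Finset (AdmQ W K p)) (q : AdmQ W K p), Odd n.card → q ∉ n →
          ∀ m : Finset {ℓ // Zhang2014.IsKolyvaginPrime (W.conductorNorm ℤ) W K p ℓ},
          (∃ v : HeightOneSpectrum (𝓞 K), ((q : ℕ) : 𝓞 K) ∈ v.asIdeal ∧
            κ₀ m (insert q n) ∉ (W.baseChange K).torsionLocalKer (v.adicCompletion K) ((p ^ 1 : ℕ) : ℤ)) ↔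
            lam m n ≠ 0) := by
  sorry

/-- stub S4 — THE LEVEL-RAISED SEED ON THE DIVISIBLE LOCUS (OPEN; the HARDEST stub; the BDP engine lives here). At a ♯ additive frame
whose bottom total canonical `p`-Selmer rank is `≥ 2` (hence `≥ 3` by parity; on this locus `c(1) = 0`, i.e. `p ∣ [E(K) : ℤy_K]`, by the
proved bottom row): a bipartite datum at `p²`-level (rows exactly as the socket `levelKolyvaginSystemsAdditive_of_seed_free`: realisation
at `∅`, sign at non-empty even levels, Kummer off `m ∪ n`, Kummer at `∞`, toric on `n`, transverse on `m`, relation (8.1), laws (A)/(B)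
two-sided) TOGETHER WITH ONE level `n₀` of total canonical rank `≤ 1` carrying a UNIT SEED in the conductor-one slice (`κ₀ ∅ n₀ ≠ 0` at
even `n₀`, or `λ ∅ n₀ ≠ 0` at odd `n₀`). Intended engine (W. Zhang's base case transported to `p² ∣ N`): choose admissible `q₁, …, q_s`
lowering the total rank to `1` at `n₀ = {q₁,…,q_s}` (`s` even; rank lowering = the route's proved `selQP_raise_free` ∕ Čebotarev), then
`κ₀ ∅ n₀` = the Heegner class mod `𝔭` of the level-raised newform `g_{n₀}` on the Shimura curve `X_{N⁺ = N, N⁻ = ∏n₀}` is NON-ZERO by the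
rank-one converse for `g_{n₀}` at the additive prime `p`: (C1) the `p`-adic Waldspurger formula of Liu–Zhang–Zhang for `(g_{n₀}, K, 𝟙)` on a
general Shimura curve [cite: LiuZhangZhang2018, Thm. 1.5.1, Thm. 1.5.3, Thm. 3.4.4] (general `B` NOT yet typed in the tree; the typed fact
`thm151_thm153_modularCurve_heegnerVector_additive` is the modular-curve case), (C2) the Wan-direction anticyclotomic divisibility for
`g_{n₀}` (supercuspidal ∕ ramified principal series at `p`) and (C3) anticyclotomic control for `A_{g_{n₀}}[𝔭] ≅ E[p]` (needs `E(K_𝔭)[p] = 0`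
as a control input: NOT automatic — (5, II), (5, III), (7, II) Kodaira cells, TRIAGE §4; the exceptional cell is a sub-residual INSIDE this
stub). Alternative engines for the same statement (not claimed): Kato ∕ Fouquet–Wan integral Perrin-Riou at additive `p` (TRIAGE v9's
`IntegralPerrinRiouAdditive'`, the retyped form) or line `additive_fibre_ignition`'s (γ′) + level climb. Why it might fail: level raising
with prescribed type at `p² ∣ N⁺` and the bipartite laws there are unprinted (as K1); (C2) for supercuspidal `Π_p` is unprinted (Wan 2020
wants `N` square-free), and every printed (C2)-engine is integral only through the congruence number `η_g` (the «η hole», TRIAGE-r1-2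
(G3-3)). Sources: [cite: WZhang2014, Thm. 1.1, §9 (proof of Thm. 9.1)] [cite: BertoliniDarmon2005, Thm. 4.1–4.2] [cite: LiuZhangZhang2018,
Thm. 1.5.3] [cite: Castella2018, Thm. 2.3]. -/
theorem stub_raisedSeedDivisibleLocus :
    PublishedInputsAdditiveKoly → PublishedDualityInputsAdditiveKoly →
    ∀ (W : WeierstrassCurve ℚ) [W.IsElliptic] [W.IsGloballyMinimal] [NeZero (W.conductorNorm ℤ)]
      (p : ℕ) [Fact p.Prime] (K : Type) [Field K] [NumberField K]
      (Dt : ModularParametrizationData W (W.conductorNorm ℤ)) (β : ℤ) (ι : K →+* ℂ),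
      5 ≤ p → Addv W p → W.HasSurjectiveModNGaloisRep p →
      (∀ (ℓ : ℕ) [Fact ℓ.Prime], W.HasMultiplicativeReductionAtPrime ℓ →
        ¬ p ∣ padicValInt ℓ W.minimalDiscriminantInt) →
      (∃ (ℓ₁ ℓ₂ : ℕ) (_ : Fact ℓ₁.Prime) (_ : Fact ℓ₂.Prime), ℓ₁ ≠ ℓ₂ ∧
        W.HasMultiplicativeReductionAtPrime ℓ₁ ∧ W.HasMultiplicativeReductionAtPrime ℓ₂) →
      ¬ p ∣ W.tamagawaProduct → W.analyticRank = 1 →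
      IsImaginaryQuadratic K → Odd (NumberField.discr K) → NumberField.discr K < -4 →
      SatisfiesHeegnerHypothesis (W.conductorNorm ℤ) K →
      (W.quadraticTwist (NumberField.discr K : ℚ)).entireLFunction 1 ≠ 0 →
      (4 * (W.conductorNorm ℤ : ℤ)) ∣ β ^ 2 - NumberField.discr K → ¬ (p : ℤ) ∣ Dt.c →
      ∀ (c : K ≃ₐ[ℚ] K), c ≠ 1 → ∀ [Module (ZMod p) (Vp W K p)],
      2 ≤ finrank (ZMod p) (SelQP W K p c ∅ true) + finrank (ZMod p) (SelQP W K p c ∅ false) →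
      ∃ (ε₀ : Finset (AdmQ W K p) → Bool)
        (κ₀ : Finset {ℓ // Zhang2014.IsKolyvaginPrime (W.conductorNorm ℤ) W K p ℓ} → Finset (AdmQ W K p) → Vp W K p)
        (lam : Finset {ℓ // Zhang2014.IsKolyvaginPrime (W.conductorNorm ℤ) W K p ℓ} → Finset (AdmQ W K p) → ZMod p)
        (n₀ : Finset (AdmQ W K p)),
        -- realisation at level `∅`
        (∀ m : Finset {ℓ // Zhang2014.IsKolyvaginPrime (W.conductorNorm ℤ) W K p ℓ},
          ∃ d : KolyvaginHeegnerData Dt β ι (∏ ℓ ∈ m, (ℓ : ℕ)), κ₀ m ∅ = d.kolyvaginClass (Fact.out : p.Prime) 1) ∧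
        -- sign
        (∀ n : Finset (AdmQ W K p), n.Nonempty → Even n.card →
          ∀ m : Finset {ℓ // Zhang2014.IsKolyvaginPrime (W.conductorNorm ℤ) W K p ℓ},
          conjAct W c ((p ^ 1 : ℕ) : ℤ) (κ₀ m n) = sgnP (ε₀ n ^^ Nat.bodd m.card) • κ₀ m n) ∧
        -- selmer_off
        (∀ n : Finset (AdmQ W K p), n.Nonempty → Even n.card →
          ∀ (m : Finset {ℓ // Zhang2014.IsKolyvaginPrime (W.conductorNorm ℤ) W K p ℓ}) (v : HeightOneSpectrum (𝓞 K)),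
          (∀ ℓ ∈ m, ((ℓ : ℕ) : 𝓞 K) ∉ v.asIdeal) → (∀ q ∈ n, ((q : ℕ) : 𝓞 K) ∉ v.asIdeal) →
          κ₀ m n ∈ selmerLocalKer (W.baseChange K) (v.adicCompletion K) ((p ^ 1 : ℕ) : ℤ)) ∧
        -- selmer_inf
        (∀ n : Finset (AdmQ W K p), n.Nonempty → Even n.card →
          ∀ (m : Finset {ℓ // Zhang2014.IsKolyvaginPrime (W.conductorNorm ℤ) W K p ℓ}) (w : InfinitePlace K),
          κ₀ m n ∈ selmerLocalKer (W.baseChange K) w.Completion ((p ^ 1 : ℕ) : ℤ)) ∧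
        -- toric_on
        (∀ n : Finset (AdmQ W K p), n.Nonempty → Even n.card →
          ∀ m : Finset {ℓ // Zhang2014.IsKolyvaginPrime (W.conductorNorm ℤ) W K p ℓ}, ∀ q ∈ n,
          ∀ v : HeightOneSpectrum (𝓞 K), ((q : ℕ) : 𝓞 K) ∈ v.asIdeal →
          κ₀ m n ∈ toricLocalKer (W.baseChange K) (v.adicCompletion K) ((p ^ 1 : ℕ) : ℤ)) ∧
        -- transverse_on
        (∀ n : Finset (AdmQ W K p), n.Nonempty → Even n.card →
          ∀ m : Finset {ℓ // Zhang2014.IsKolyvaginPrime (W.conductorNorm ℤ) W K p ℓ}, ∀ ℓ ∈ m,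
          ∀ v : HeightOneSpectrum (𝓞 K), ((ℓ : ℕ) : 𝓞 K) ∈ v.asIdeal → κ₀ m n ∈ transverseLocalKerP W K p ι ℓ v) ∧
        -- relation (8.1)
        (∀ n : Finset (AdmQ W K p), n.Nonempty → Even n.card →
          ∀ (m : Finset {ℓ // Zhang2014.IsKolyvaginPrime (W.conductorNorm ℤ) W K p ℓ})
            (ℓ : {ℓ // Zhang2014.IsKolyvaginPrime (W.conductorNorm ℤ) W K p ℓ}), ℓ ∉ m →
          ∀ v : HeightOneSpectrum (𝓞 K), ((ℓ : ℕ) : 𝓞 K) ∈ v.asIdeal →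
          (κ₀ (insert ℓ m) n ∈ (W.baseChange K).torsionLocalKer (v.adicCompletion K) ((p ^ 1 : ℕ) : ℤ) ↔
            κ₀ m n ∈ (W.baseChange K).torsionLocalKer (v.adicCompletion K) ((p ^ 1 : ℕ) : ℤ))) ∧
        -- law (A), TWO-SIDED
        (∀ (n : Finset (AdmQ W K p)) (q : AdmQ W K p), Even n.card → q ∉ n →
          ∀ m : Finset {ℓ // Zhang2014.IsKolyvaginPrime (W.conductorNorm ℤ) W K p ℓ},
          lam m (insert q n) ≠ 0 ↔ ∃ v : HeightOneSpectrum (𝓞 K), ((q : ℕ) : 𝓞 K) ∈ v.asIdeal ∧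
            κ₀ m n ∉ (W.baseChange K).torsionLocalKer (v.adicCompletion K) ((p ^ 1 : ℕ) : ℤ)) ∧
        -- law (B), TWO-SIDED
        (∀ (n : Finset (AdmQ W K p)) (q : AdmQ W K p), Odd n.card → q ∉ n →
          ∀ m : Finset {ℓ // Zhang2014.IsKolyvaginPrime (W.conductorNorm ℤ) W K p ℓ},
          (∃ v : HeightOneSpectrum (𝓞 K), ((q : ℕ) : 𝓞 K) ∈ v.asIdeal ∧
            κ₀ m (insert q n) ∉ (W.baseChange K).torsionLocalKer (v.adicCompletion K) ((p ^ 1 : ℕ) : ℤ)) ↔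
            lam m n ≠ 0) ∧
        -- ONE seed at a level of total canonical rank ≤ 1, in the conductor-one slice
        finrank (ZMod p) (SelQP W K p c n₀ true) + finrank (ZMod p) (SelQP W K p c n₀ false) ≤ 1 ∧
        ((Even n₀.card ∧ κ₀ ∅ n₀ ≠ 0) ∨ (Odd n₀.card ∧ lam ∅ n₀ ≠ 0)) := by
  sorry

/-- stub S5 — THE HEEGNER-INDEX LOWER BOUND AT AN ADDITIVE PRIME (OPEN; engine-shaped; replaces v2's `stub_bottomConverseAdditive`;
v4: conclusion in X11b's `hL` shape (b) — at the FRAME's Heegner points `P ↦ heegnerPointComplex Dt H`, `H.β = β` — per TRIAGE-r1-1 v13).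
At a ♯ additive frame (`p ≥ 5`, `Addv W p`, `ρ̄_{E,p}` onto, ♠(1)(2), `p ∤ ∏c_ℓ`, `r_an(E) = 1`, `K` imaginary quadratic with odd
`d_K < −4` and the Heegner hypothesis for `N_E`, `L(E^{(d_K)}, 1) ≠ 0`, an orientation `β`, `p ∤ c_Manin(Dt)`), for EVERY Heegner point
`P = y_K ∈ E(K)` of infinite order: `X11b.IndexLowerBoundAt W p K P`, i.e. `2·ord_p [E(K) : ℤP] ≤ ord_p #Ш(E/K) + 2·ord_p ∏_ℓ c_ℓ(E/ℚ)`
— STEP L of Jetchev–Skinner–Wan ∕ Castella, the SAME typed predicate the sibling class X11b carries as its one open input at `p ∥ N`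
(`Summits/BirchSwinnertonDyer/Rank1Residual/X11b/BDPRoute.lean`; decomposition into tree objects there:
`indexLowerBoundAt_of_onTreeLowerLinks_of_heegner` = anticyclotomic control (CTL)ᵗ + (IMC ⊇ ∘ BDP)ᵗ), here at `p² ∣ N`. On its frames
`Ш(E/K)` is finite (GZ + Kolyvagin, PUB), so `shaOrder` is not a junk value. Engines (none claimed): (E1) on the weight-2-avatar cells
((5, II*), (5, III)^split, (7, II)^split — TRIAGE-r1-2 G11-2) the crux's card `Ideas/residual-bdp-transport.md` ([AV] + RT-an + RT-alg + LOC +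
GV-pinning + ONE rational one-sided divisibility (ii) for `f_E` + LZZ (C1) + control (C3) ⟹ `IndexLowerBoundAt`); (E2) natively: (C1) the
`p`-adic Waldspurger formula of Liu–Zhang–Zhang at the additive prime (tree fact `thm151_thm153_modularCurve_heegnerVector_additive`,
modular-curve case), (C2) the one-sided anticyclotomic divisibility `Ch(X_ac(E/K_∞)) ⊆ (L_p^BDP(E/K))` for `Π_p` supercuspidal ∕ ramified
principal series (in print only as the Fouquet–Wan claim, arXiv:2107.13726 Thm. 4.41, unrefereed; every printed engine is integral only
through the congruence number — the «η hole», TRIAGE-r1-2 (G3-3)), (C3) anticyclotomic control at additive `p` (local term at `p`: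
`Ẽ_ns(𝔽_p) ≅ 𝔾_a`, so `[E(ℚ_p) : E₁(ℚ_p)] = p·c_p` and `E(K_𝔭)[p]` may be non-zero on the Kodaira II ∕ III cells — NOT the multiplicative
shape `(1 − a_p p⁻¹)` of X11b's (CTL)ᵗ); (E3) on the Kriz–Li (γ)-certificate locus it holds outright mod `thm116` (there `c(1) ≠ 0`, so the
left side is `0`; tree p605510 ∕ p604313). Why it might fail: as typed it follows from BSD (it is the `≤` half of the `p`-part of
Gross–Zagier's conjecture over `K`), so the risk is not falsity but that at a supercuspidal `p` no divisibility (C2) gets proved — the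
statement is then exactly as hard as the additive rank-one `p`-part. Sources: [cite: JetchevSkinnerWan2017, §7.4.1 (eq:shalowerK-1), Thm. 3.3.1]
[cite: Castella2018, (1.1), Thm. 2.3, (5.2)] [cite: LiuZhangZhang2018, Thm. 1.5.1, Thm. 1.5.3] [cite: WZhang2014, Thm. 1.4 (Thm. 10.2)]
[cite: KrizLi2019, Thm. 1.16]; arXiv:2107.13726 (Thm. 4.41). -/
theorem stub_indexLowerBoundAdditive :
    PublishedInputsAdditiveKoly → PublishedDualityInputsAdditiveKoly →
    ∀ (W : WeierstrassCurve ℚ) [W.IsElliptic] [W.IsGloballyMinimal] [NeZero (W.conductorNorm ℤ)]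
      (p : ℕ) [Fact p.Prime] (K : Type) [Field K] [NumberField K]
      (Dt : ModularParametrizationData W (W.conductorNorm ℤ)) (β : ℤ) (ι : K →+* ℂ),
      5 ≤ p → Addv W p → W.HasSurjectiveModNGaloisRep p →
      (∀ (ℓ : ℕ) [Fact ℓ.Prime], W.HasMultiplicativeReductionAtPrime ℓ →
        ¬ p ∣ padicValInt ℓ W.minimalDiscriminantInt) →
      (∃ (ℓ₁ ℓ₂ : ℕ) (_ : Fact ℓ₁.Prime) (_ : Fact ℓ₂.Prime), ℓ₁ ≠ ℓ₂ ∧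
        W.HasMultiplicativeReductionAtPrime ℓ₁ ∧ W.HasMultiplicativeReductionAtPrime ℓ₂) →
      ¬ p ∣ W.tamagawaProduct → W.analyticRank = 1 →
      IsImaginaryQuadratic K → Odd (NumberField.discr K) → NumberField.discr K < -4 →
      SatisfiesHeegnerHypothesis (W.conductorNorm ℤ) K →
      (W.quadraticTwist (NumberField.discr K : ℚ)).entireLFunction 1 ≠ 0 →
      (4 * (W.conductorNorm ℤ : ℤ)) ∣ β ^ 2 - NumberField.discr K → ¬ (p : ℤ) ∣ Dt.c →
      ∀ (H : HeegnerDatum (W.conductorNorm ℤ) (NumberField.discr K)) (P : (W.baseChange K).toAffine.Point),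
        H.β = β → WeierstrassCurve.Affine.Point.map ι.toRatAlgHom P = heegnerPointComplex Dt H → ¬ IsOfFinAddOrder P →
        Summit.BirchSwinnertonDyer.Rank1Residual.X11b.IndexLowerBoundAt W p K P := by
  -- v4: X11b's `hL` shape (b) — the FRAME's Heegner points (`Dt`, `β`, `ι` bound above), not `IsHeegnerPoint` (∃ over all data).
  sorry

/-! ## The bottom row on the indivisible locus — PROVED (Kolyvagin's direction, from the displayed published inputs) -/

/-- `ℤy` is `p`-saturated in an abelian group without `p`-torsion when `y ∉ p·A` (Bezout). [folklore] -/
theorem zmultiples_saturated_of_not_exists_zsmul_eq {A : Type*} [AddCommGroup A] {p : ℕ} (hp : p.Prime) {y : A}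
    (htor : AddSubgroup.torsionBy A (p : ℤ) = ⊥) (hy : ¬ ∃ Q : A, (p : ℤ) • Q = y) :
    ∀ g : A, p • g ∈ AddSubgroup.zmultiples y → g ∈ AddSubgroup.zmultiples y := by
  intro g hg
  obtain ⟨k, hk⟩ := AddSubgroup.mem_zmultiples_iff.mp hg
  -- `hk : k • y = p • g`
  by_cases hpk : (p : ℤ) ∣ k
  · obtain ⟨k', rfl⟩ := hpk
    have hmem : g - k' • y ∈ AddSubgroup.torsionBy A (p : ℤ) := by
      refine AddSubgroup.torsionBy.nsmul_iff.mpr ?_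
      rw [smul_sub, sub_eq_zero, ← hk, ← natCast_zsmul, smul_smul]
    rw [htor, AddSubgroup.mem_bot, sub_eq_zero] at hmem
    rw [hmem]
    exact AddSubgroup.zsmul_mem _ (AddSubgroup.mem_zmultiples y) k'
  · exfalso
    have hcop : IsCoprime (p : ℤ) k := by
      rw [Int.isCoprime_iff_gcd_eq_one]
      have hnat : Nat.Coprime p k.natAbs :=
        (Nat.Prime.coprime_iff_not_dvd hp).mpr fun h ↦ hpk (Int.natCast_dvd.mpr h)
      simpa [Int.gcd, Int.natAbs_natCast] using hnat
    obtain ⟨a, b, hab⟩ := hcop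
    apply hy
    refine ⟨a • y + b • g, ?_⟩
    have hk' : k • y = (p : ℤ) • g := by rw [hk, natCast_zsmul]
    calc (p : ℤ) • (a • y + b • g) = (a * p) • y + b • ((p : ℤ) • g) := by
          rw [smul_add, smul_smul, smul_smul, mul_comm (p : ℤ) a, mul_comm (p : ℤ) b, ← smul_smul b]
      _ = y := by rw [← hk', smul_smul, ← add_smul, hab, one_smul]

/-- **The in-print bottom row (Kolyvagin's direction), PROVED from the displayed published inputs.** On the crux's frames (`p ≥ 5`,
`ρ̄_{E,p}` onto, `K` imaginary quadratic with `d_K < −4` and the Heegner hypothesis for `N_E`, `c ≠ 1`): if a conductor-one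
Kolyvagin–Heegner datum has NON-ZERO class `c(1) ∈ H¹(K, E[p])`, then the bottom total canonical `p`-Selmer rank is EXACTLY ONE.
Chain: `c(1) ≠ 0` ⟹ `y_K ∉ pE(K)` (`kolyvaginClass_one_ne_zero_iff_not_exists_zsmul_eq`, `y_K` under `P(1)` by
`exists_isHeegnerPoint_map_eq_derivedPoint_one`) ⟹ `y_K` non-torsion (`E(K)[p] = 0`) ⟹ `rank E(K) = 1 ∧ Ш(E/K)` finite (PUB conjunct
`kolyvagin`) and `ord_p #Ш ≤ 2·ord_p [E(K) : ℤy_K]` (PUB conjunct `Kolyvagin1990_padicValNat_card_sha_le`) with `p ∤ [E(K) : ℤy_K]`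
(`ℤy_K` is `p`-saturated) ⟹ `Ш(E/K)[p] = 0` (Lagrange) ⟹ `#Sel_p(E/K) = p¹·#E(K)[p]·#Ш[p] = p` (`natCard_selmerGroup_eq`) ⟹
`dim Sel_∅⁺ + dim Sel_∅⁻ = 1` (`finrank_selQP_empty_add_eq_one_iff`). [cite: Kolyvagin1990, Thm. A] [cite: GrossLMS1991, §1 Thm. 1.3,
§2 Prop. 2.1 (2)] [cite: McCallumLMS1991, §1] [cite: SilvermanAEC2009, Thm X.4.2] -/
theorem finrank_selQP_empty_eq_one_of_kolyvaginClass_one_ne_zero (hPUB : PublishedInputsAdditiveKoly)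
    (W : WeierstrassCurve ℚ) [W.IsElliptic] [W.IsGloballyMinimal] [NeZero (W.conductorNorm ℤ)]
    (p : ℕ) [Fact p.Prime] (K : Type) [Field K] [NumberField K]
    (Dt : ModularParametrizationData W (W.conductorNorm ℤ)) (β : ℤ) (ι : K →+* ℂ)
    (h5 : 5 ≤ p) (hsurj : W.HasSurjectiveModNGaloisRep p) (hK : IsImaginaryQuadratic K)
    (hlt : NumberField.discr K < -4) (hH : SatisfiesHeegnerHypothesis (W.conductorNorm ℤ) K)
    (c : K ≃ₐ[ℚ] K) [Module (ZMod p) (Vp W K p)]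
    (d : KolyvaginHeegnerData Dt β ι 1) (hne : d.kolyvaginClass (Fact.out : p.Prime) 1 ≠ 0) :
    finrank (ZMod p) (SelQP W K p c ∅ true) + finrank (ZMod p) (SelQP W K p c ∅ false) = 1 := by
  have hp : p.Prime := Fact.out
  have hp2 : p ≠ 2 := by omega
  -- `y_K ∈ E(K)` under `P(1)`, and `c(1) ≠ 0 ⟹ y_K ∉ pE(K)`
  obtain ⟨yK, hyK, hmap⟩ := exists_isHeegnerPoint_map_eq_derivedPoint_one W K Dt β ι hK hH d
  have hndiv : ¬ ∃ Q : (W.baseChange K).toAffine.Point, (p : ℤ) • Q = yK :=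
    (kolyvaginClass_one_ne_zero_iff_not_exists_zsmul_eq W p K Dt β ι h5 hsurj hK hlt hH d yK hmap).mp hne
  have hirr : W.HasIrreducibleModPGaloisRep p := hasIrreducibleModPGaloisRep_of_hasSurjectiveModNGaloisRep W p hsurj
  have hnt : ¬ IsOfFinAddOrder yK := not_isOfFinAddOrder_of_not_exists_zsmul_eq W hK hp hirr hndiv
  -- Kolyvagin: `rank E(K) = 1`, `Ш(E/K)` finite
  obtain ⟨hr1, hfin⟩ := hPUB.2.1 (W.conductorNorm ℤ) W K hK hH hyK hnt
  haveI : Finite (W.baseChange K).sha := hfin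
  -- `E(K)[p] = 0`
  have hbot := torsionBy_eq_bot_of_isImaginaryQuadratic_of_hasIrreducibleModPGaloisRep W K hK hp hirr
  -- `p ∤ [E(K) : ℤ y_K]`: the index is finite (rank one) and `ℤ y_K` is `p`-saturated
  have hidx0 : (AddSubgroup.zmultiples yK).index ≠ 0 :=
    index_zmultiples_ne_zero_of_isHeegnerPoint (W.conductorNorm ℤ) W K (hPUB.2.1 (W.conductorNorm ℤ) W K) hK hH hyK hnt
  haveI : (AddSubgroup.zmultiples yK).FiniteIndex := ⟨hidx0⟩
  have hI : ¬ p ∣ (AddSubgroup.zmultiples yK).index :=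
    not_dvd_index_of_saturated _ (zmultiples_saturated_of_not_exists_zsmul_eq hp hbot hndiv)
  -- Kolyvagin's bound ⟹ `ord_p #Ш(E/K) = 0`
  have hsha0 : padicValNat p (Nat.card (W.baseChange K).sha) = 0 :=
    padicValNat_card_sha_eq_zero_of_not_dvd_index (hPUB.2.2.1 (W.conductorNorm ℤ) W K) hK hH hyK hnt hp hp2 hsurj hI
  have hndvd : ¬ p ∣ Nat.card (W.baseChange K).sha := by
    rcases padicValNat.eq_zero_iff.mp hsha0 with h | h | h
    · exact absurd h hp.one_lt.ne'
    · exact absurd h Nat.card_pos.ne'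
    · exact h
  -- ⟹ `Ш(E/K) ⊓ H¹(K, E)[p] = 0` (Lagrange: an element of order dividing `p` in a finite group of order prime to `p` is `0`)
  have hb : ((W.baseChange K).sha ⊓ AddSubgroup.torsionBy (W.baseChange K).galH1 (p : ℤ) :
      AddSubgroup (W.baseChange K).galH1) = ⊥ := by
    refine (AddSubgroup.eq_bot_iff_forall _).mpr fun x hx ↦ ?_
    obtain ⟨hxs, hxt⟩ := AddSubgroup.mem_inf.mp hx
    have hpx : p • x = 0 := AddSubgroup.torsionBy.nsmul_iff.mp hxt
    have h1 : addOrderOf x ∣ p := addOrderOf_dvd_of_nsmul_eq_zero hpx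
    have h2 : addOrderOf x ∣ Nat.card (W.baseChange K).sha := by
      rw [← AddSubgroup.addOrderOf_mk x hxs]
      exact addOrderOf_dvd_natCard _
    rcases (Nat.dvd_prime hp).mp h1 with h | h
    · exact AddMonoid.addOrderOf_eq_one_iff.mp h
    · rw [h] at h2
      exact absurd h2 hndvd
  have hsha1 : Nat.card ((W.baseChange K).sha ⊓ AddSubgroup.torsionBy (W.baseChange K).galH1 (p : ℤ) :
      AddSubgroup (W.baseChange K).galH1) = 1 := by
    rw [hb]; exact AddSubgroup.card_bot
  -- the exact descent count `#Sel_p(E/K) = p^rank · #E(K)[p] · #Ш[p] = p`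
  have ht : Nat.card (AddSubgroup.torsionBy (W.baseChange K).toAffine.Point (p : ℤ)) = 1 := by
    rw [hbot]; exact AddSubgroup.card_bot
  have hcard := (W.baseChange K).natCard_selmerGroup_eq hp.ne_zero
  rw [hr1, pow_one, ht, mul_one, hsha1, mul_one] at hcard
  -- read as `dim Sel_∅⁺ + dim Sel_∅⁻ = 1`
  have hcc : c * c = 1 := Method2.algEquiv_mul_self_eq_one K hK c
  have e1 : ((p ^ 1 : ℕ) : ℤ) = (p : ℤ) := by rw [pow_one]
  rw [finrank_selQP_empty_add_eq_one_iff W K p hp2 hK c hcc, e1]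
  exact hcard

/-! ## The bottom converse from the index lower bound — PROVED (the reduction behind stub S5) -/

/-- If `y = p • Q` with `y` of infinite order, then `p ∣ [A : ℤy]` (the class of `Q` has order `p` in `A/ℤy`). [folklore] -/
theorem dvd_index_zmultiples_of_exists_zsmul_eq {A : Type*} [AddCommGroup A] {p : ℕ} [hp : Fact p.Prime] {y : A}
    (hnt : ¬ IsOfFinAddOrder y) (hy : ∃ Q : A, (p : ℤ) • Q = y) : p ∣ (AddSubgroup.zmultiples y).index := by
  obtain ⟨Q, hQ⟩ := hy
  set q : A ⧸ AddSubgroup.zmultiples y := QuotientAddGroup.mk Q with hq_def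
  have hq0 : q ≠ 0 := by
    intro h0
    rw [hq_def, QuotientAddGroup.eq_zero_iff, AddSubgroup.mem_zmultiples_iff] at h0
    obtain ⟨k, hk⟩ := h0
    apply hnt
    rw [isOfFinAddOrder_iff_zsmul_eq_zero]
    refine ⟨(p : ℤ) * k - 1, ?_, ?_⟩
    · intro h
      have hdvd : (p : ℤ) ∣ 1 := ⟨k, by linarith⟩
      have hp1 : (p : ℤ) = 1 := Int.eq_one_of_dvd_one (by positivity) hdvd
      exact hp.out.one_lt.ne' (by exact_mod_cast hp1)
    · rw [sub_smul, one_smul, ← smul_smul, hk, hQ, sub_self]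
  have hpq : p • q = 0 := by
    rw [hq_def, ← QuotientAddGroup.mk_nsmul, QuotientAddGroup.eq_zero_iff, ← natCast_zsmul, hQ]
    exact AddSubgroup.mem_zmultiples y
  have hord : addOrderOf q = p := addOrderOf_eq_prime hpq hq0
  rw [← hord]
  exact addOrderOf_dvd_natCard q

/-- **The bottom converse at an additive prime FROM the index lower bound (v2's stub S5, now a theorem modulo S5; v4: S5 in `hL` shape).** On the crux's
frames (`p ≥ 5`, `ρ̄_{E,p}` onto, `p ∤ ∏c_ℓ`, `r_an(E) = 1`, `K` imaginary quadratic with `d_K < −4`, the Heegner hypothesis for `N_E`,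
`L(E^{(d_K)}, 1) ≠ 0`): if the bottom total canonical `p`-Selmer rank is `≤ 1` and the Heegner-index lower bound `IndexLowerBoundAt W p K P`
holds at every Heegner point of infinite order, then EVERY conductor-one Kolyvagin–Heegner datum has `c(1) ≠ 0`. Chain: `y_K` (under
`P(1)`, `exists_isHeegnerPoint_map_eq_derivedPoint_one`) is non-torsion (`X11b.not_isOfFinAddOrder_of_heegner_of_analyticRank_eq_one`: GZ +
modularity, PUB) ⟹ `rank E(K) = 1`, `Ш(E/K)` finite (`kolyvagin`, PUB) ⟹ `#Sel_p = p·#(Ш ⊓ H¹[p])` (`natCard_selmerGroup_eq`, `E(K)[p] = 0`)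
and `#Sel_p = p^{rank_∅} ≤ p` (`natCard_selmer_eq_pow_finrank_selQP_add`) ⟹ `Ш ⊓ H¹[p] = 0` ⟹ `p ∤ #Ш(E/K)` (Cauchy) ⟹ (lower bound,
`p ∤ ∏c_ℓ`) `ord_p [E(K) : ℤy_K] = 0` with the index non-zero (`index_zmultiples_ne_zero_of_isHeegnerPoint`) ⟹ `y_K ∉ pE(K)`
(`dvd_index_zmultiples_of_exists_zsmul_eq`) ⟹ `c(1) ≠ 0` (`kolyvaginClass_one_ne_zero_iff_not_exists_zsmul_eq`).
[cite: JetchevSkinnerWan2017, §7.4.3] [cite: GrossLMS1991, §2 Prop. 2.1 (2), Conj. (2.2)] [cite: SilvermanAEC2009, Thm X.4.2] -/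
theorem kolyvaginClass_one_ne_zero_of_indexLowerBoundAt (hPUB : PublishedInputsAdditiveKoly)
    (W : WeierstrassCurve ℚ) [W.IsElliptic] [W.IsGloballyMinimal] [NeZero (W.conductorNorm ℤ)]
    (p : ℕ) [Fact p.Prime] (K : Type) [Field K] [NumberField K]
    (Dt : ModularParametrizationData W (W.conductorNorm ℤ)) (β : ℤ) (ι : K →+* ℂ)
    (h5 : 5 ≤ p) (hsurj : W.HasSurjectiveModNGaloisRep p) (htam : ¬ p ∣ W.tamagawaProduct) (hr1 : W.analyticRank = 1)
    (hK : IsImaginaryQuadratic K) (hlt : NumberField.discr K < -4) (hH : SatisfiesHeegnerHypothesis (W.conductorNorm ℤ) K)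
    (hLt : (W.quadraticTwist (NumberField.discr K : ℚ)).entireLFunction 1 ≠ 0)
    (hβ : (4 * (W.conductorNorm ℤ : ℤ)) ∣ β ^ 2 - NumberField.discr K)
    (c : K ≃ₐ[ℚ] K) [Module (ZMod p) (Vp W K p)]
    (hrk : finrank (ZMod p) (SelQP W K p c ∅ true) + finrank (ZMod p) (SelQP W K p c ∅ false) ≤ 1)
    (hILB : ∀ (H : HeegnerDatum (W.conductorNorm ℤ) (NumberField.discr K)) (P : (W.baseChange K).toAffine.Point),
      H.β = β → WeierstrassCurve.Affine.Point.map ι.toRatAlgHom P = heegnerPointComplex Dt H → ¬ IsOfFinAddOrder P →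
      Summit.BirchSwinnertonDyer.Rank1Residual.X11b.IndexLowerBoundAt W p K P)
    (d : KolyvaginHeegnerData Dt β ι 1) : d.kolyvaginClass (Fact.out : p.Prime) 1 ≠ 0 := by
  have hp : p.Prime := Fact.out
  have hp2 : p ≠ 2 := by omega
  -- `y_K ∈ E(K)` under `P(1)`
  obtain ⟨yK, hyK, hmap⟩ := exists_isHeegnerPoint_map_eq_derivedPoint_one W K Dt β ι hK hH d
  refine (kolyvaginClass_one_ne_zero_iff_not_exists_zsmul_eq W p K Dt β ι h5 hsurj hK hlt hH d yK hmap).mpr ?_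
  intro hdivQ
  -- `y_K` is non-torsion: Gross–Zagier + modularity on the frame (`r_an(E) = 1`, `L(E^{d_K},1) ≠ 0`)
  have hnt : ¬ IsOfFinAddOrder yK := by
    obtain ⟨Dt', H', ι', hP'⟩ := hyK
    exact Summit.BirchSwinnertonDyer.Rank1Residual.X11b.not_isOfFinAddOrder_of_heegner_of_analyticRank_eq_one W
      (W.conductorNorm ℤ) K Dt' H' ι' yK (hPUB.1 _ W K) hPUB.2.2.2.2.1 hr1 hK hH hLt hP'
  -- Kolyvagin: `rank E(K) = 1`, `Ш(E/K)` finite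
  obtain ⟨hr1K, hfin⟩ := hPUB.2.1 (W.conductorNorm ℤ) W K hK hH hyK hnt
  haveI : Finite (W.baseChange K).sha := hfin
  -- `E(K)[p] = 0`
  have hirr : W.HasIrreducibleModPGaloisRep p := hasIrreducibleModPGaloisRep_of_hasSurjectiveModNGaloisRep W p hsurj
  have hbot := torsionBy_eq_bot_of_isImaginaryQuadratic_of_hasIrreducibleModPGaloisRep W K hK hp hirr
  have ht : Nat.card (AddSubgroup.torsionBy (W.baseChange K).toAffine.Point (p : ℤ)) = 1 := by
    rw [hbot]; exact AddSubgroup.card_bot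
  -- the exact descent count `#Sel_p = p · #(Ш ⊓ H¹[p])`
  have hcard := (W.baseChange K).natCard_selmerGroup_eq hp.ne_zero
  rw [hr1K, pow_one, ht, mul_one] at hcard
  -- the eigen-count `#Sel_p = p ^ rank_∅`
  have hcc : c * c = 1 := Method2.algEquiv_mul_self_eq_one K hK c
  have hpow := natCard_selmer_eq_pow_finrank_selQP_add W K p hp2 hK c hcc
  -- name the exponent first (its instance terms mention the level `p ^ 1`), then pass to level `p`
  set r := finrank (ZMod p) (SelQP W K p c ∅ true) + finrank (ZMod p) (SelQP W K p c ∅ false) with hr_def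
  have e1 : ((p ^ 1 : ℕ) : ℤ) = (p : ℤ) := by rw [pow_one]
  rw [e1] at hpow
  set s := Nat.card ((W.baseChange K).sha ⊓ AddSubgroup.torsionBy (W.baseChange K).galH1 (p : ℤ) :
    AddSubgroup (W.baseChange K).galH1) with hs_def
  -- `p · s = p ^ rank_∅ ≤ p`, and `s ≠ 0`; so `s = 1`
  have hps : p * s ≤ p * 1 := by
    rw [mul_one, ← hcard, hpow]
    calc p ^ r ≤ p ^ 1 := Nat.pow_le_pow_right hp.pos hrk
      _ = p := pow_one p
  have hs_le : s ≤ 1 := Nat.le_of_mul_le_mul_left hps hp.pos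
  have hNp : ((p : ℕ) : ℤ) ≠ 0 := by exact_mod_cast hp.ne_zero
  haveI : Finite (selmerGroup (W.baseChange K) (p : ℤ)) := (W.baseChange K).finite_selmerGroup_holds hNp
  have hs_ne : s ≠ 0 := by
    intro h0
    rw [h0, mul_zero] at hcard
    exact Nat.card_pos.ne' hcard
  have hs1 : s = 1 := by omega
  have hb : ((W.baseChange K).sha ⊓ AddSubgroup.torsionBy (W.baseChange K).galH1 (p : ℤ) :
      AddSubgroup (W.baseChange K).galH1) = ⊥ := AddSubgroup.eq_bot_of_card_eq _ hs1
  -- hence `p ∤ #Ш(E/K)` (Cauchy: an element of order `p` of `Ш` would lie in `Ш ⊓ H¹(K,E)[p] = 0`)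
  have hndvd : ¬ p ∣ Nat.card (W.baseChange K).sha := by
    intro hdvd
    obtain ⟨x, hx⟩ := exists_prime_addOrderOf_dvd_card' (G := (W.baseChange K).sha) p hdvd
    have hpx : p • (x : (W.baseChange K).galH1) = 0 := by
      rw [← AddSubgroup.coe_nsmul, ← hx, addOrderOf_nsmul_eq_zero, AddSubgroup.coe_zero]
    have hxt : (x : (W.baseChange K).galH1) ∈ AddSubgroup.torsionBy (W.baseChange K).galH1 (p : ℤ) :=
      AddSubgroup.torsionBy.nsmul_iff.mpr hpx
    have hmem : (x : (W.baseChange K).galH1) ∈ ((W.baseChange K).sha ⊓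
        AddSubgroup.torsionBy (W.baseChange K).galH1 (p : ℤ) : AddSubgroup (W.baseChange K).galH1) :=
      AddSubgroup.mem_inf.mpr ⟨x.2, hxt⟩
    rw [hb, AddSubgroup.mem_bot] at hmem
    have hx0 : x = 0 := Subtype.ext hmem
    rw [hx0, addOrderOf_zero] at hx
    exact hp.one_lt.ne' hx.symm
  -- `ord_p #Ш(E/K) = 0`, `ord_p ∏c_ℓ = 0`; the lower bound forces `ord_p [E(K) : ℤy_K] = 0`
  have hsha0 : padicValNat p (W.baseChange K).shaOrder = 0 := by
    rw [WeierstrassCurve.shaOrder]; exact padicValNat.eq_zero_of_not_dvd hndvd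
  have htam0 : padicValNat p W.tamagawaProduct = 0 := padicValNat.eq_zero_of_not_dvd htam
  -- v4: `y_K` IS the frame's Heegner point (oriented datum `H` with `H.β = β`; Shimura reciprocity at conductor `1`, proved)
  have hDneg : NumberField.discr K < 0 := by omega
  obtain ⟨H, hHβ⟩ := exists_heegnerDatum (W.conductorNorm ℤ) hDneg hβ
  obtain ⟨P, hP⟩ := heegnerPointComplex_mem_range_map_holds (W.conductorNorm ℤ) W K hK hH Dt H ι
  have hPP : yK = P := Summit.BirchSwinnertonDyer.Rank1Residual.X11b.KolyvaginBottom.eq_of_map_eq_heegnerPointComplex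
    (heegnerPointOfConductor_one_galoisConj_holds (W.conductorNorm ℤ) W K) hK hH d hHβ hP hmap
  have hL := hILB H yK hHβ (hPP ▸ hP) hnt
  unfold Summit.BirchSwinnertonDyer.Rank1Residual.X11b.IndexLowerBoundAt at hL
  rw [hsha0, htam0] at hL
  have hidx : padicValNat p (AddSubgroup.zmultiples yK).index = 0 := by omega
  have hidx0 : (AddSubgroup.zmultiples yK).index ≠ 0 :=
    index_zmultiples_ne_zero_of_isHeegnerPoint (W.conductorNorm ℤ) W K (hPUB.2.1 (W.conductorNorm ℤ) W K) hK hH hyK hnt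
  have hI : ¬ p ∣ (AddSubgroup.zmultiples yK).index := by
    rcases padicValNat.eq_zero_iff.mp hidx with h | h | h
    · exact absurd h hp.one_lt.ne'
    · exact absurd h hidx0
    · exact h
  -- but `y_K = pQ` with `y_K` non-torsion gives `p ∣ [E(K) : ℤy_K]`
  exact hI (dvd_index_zmultiples_of_exists_zsmul_eq hnt hdivQ)

/-! ## The composition -/

/-- COMPOSITION (kernel-checked, NO `sorry` of its own): the crux `LevelKolyvaginSystemsAdditive` BY NAME from the five (sorried)
stubs, through the socket `levelKolyvaginSystemsAdditive_of_seed_free` (KS′ ⟸ PUB ∧ DUAL ∧ datum-with-seed). Per frame, CASE SPLIT ON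
THE BOTTOM CLASS: if every conductor-one datum has `c(1) ≠ 0` (INDIVISIBLE locus), take K1's datum (S3), read off its realisation
`κ₀ ∅ ∅ = c_d(1) ≠ 0` as the seed at `n₀ = ∅`, with `rank_∅ = 1` by the PROVED bottom row
`finrank_selQP_empty_eq_one_of_kolyvaginClass_one_ne_zero`; else some datum has `c(1) = 0` (DIVISIBLE locus): by S5 (the index lower bound)
and the PROVED reduction `kolyvaginClass_one_ne_zero_of_indexLowerBoundAt` the bottom total rank is `≥ 2`, and S4 hands the level-raised
datum-with-seed. -/
theorem LevelKolyvaginSystemsAdditive_of :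
    Summit.BirchSwinnertonDyer.BirchSwinnertonDyer.Theses.AdditiveKolyvaginRoad.LevelKolyvaginSystemsAdditive := by
  refine levelKolyvaginSystemsAdditive_of_seed_free stub_publishedInputs stub_publishedDuality ?_
  intro W _ _ _ p _ K _ _ Dt β ι h5 hadd hsurj hsp htwo htam hr hK hodd hlt hH hL hβ hcM c hc1 _
  by_cases hdiv : ∃ d : KolyvaginHeegnerData Dt β ι 1, d.kolyvaginClass (Fact.out : p.Prime) 1 = 0
  · -- DIVISIBLE LOCUS: `c(1) = 0` for some (hence every) conductor-one datum
    obtain ⟨d₀, hd₀⟩ := hdiv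
    have h2 : 2 ≤ finrank (ZMod p) (SelQP W K p c ∅ true) + finrank (ZMod p) (SelQP W K p c ∅ false) := by
      by_contra hlt2
      exact kolyvaginClass_one_ne_zero_of_indexLowerBoundAt stub_publishedInputs W p K Dt β ι h5 hsurj htam hr hK hlt hH hL hβ c
        (by omega)
        (stub_indexLowerBoundAdditive stub_publishedInputs stub_publishedDuality W p K Dt β ι h5 hadd hsurj hsp htwo htam hr hK hodd
          hlt hH hL hβ hcM) d₀ hd₀
    exact stub_raisedSeedDivisibleLocus stub_publishedInputs stub_publishedDuality W p K Dt β ι h5 hadd hsurj hsp htwo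
      htam hr hK hodd hlt hH hL hβ hcM c hc1 h2
  · -- INDIVISIBLE LOCUS: the seed is `c(1)` at `n₀ = ∅`; the rank clause is Kolyvagin's direction (proved above)
    obtain ⟨ε₀, κ₀, lam, hreal, hsign, hoff, hinf, htor, htr, hrel, hA, hB⟩ :=
      stub_geometricBipartiteDatum stub_publishedInputs stub_publishedDuality W p K Dt β ι h5 hadd hsurj hsp htwo htam hr
        hK hodd hlt hH hL hβ hcM c hc1
    obtain ⟨d, hd⟩ := hreal ∅
    have hne : d.kolyvaginClass (Fact.out : p.Prime) 1 ≠ 0 := fun h0 ↦ hdiv ⟨d, h0⟩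
    have h1 := finrank_selQP_empty_eq_one_of_kolyvaginClass_one_ne_zero stub_publishedInputs W p K Dt β ι h5 hsurj hK
      hlt hH c d hne
    refine ⟨ε₀, κ₀, lam, ∅, hreal, fun n _ he m ↦ hsign n he m, hoff, hinf, htor, htr, hrel, hA, hB, h1.le,
      Or.inl ⟨by simp, ?_⟩⟩
    rw [hd]
    exact hne

/-! ## Route-level reading (kernel-checked; closes nothing — it rests on the `sorry`s of S1 and S5 and on McCallum's divisibility half) -/

/-- ROUTE-LEVEL READING (v4): S1 (PUB) and S5 (ILBᵃᵈᵈ in `hL` shape) ALONE, with McCallum's Cor. 5.6 divisibility half as a displayed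
named-fact binder, give the route's crux r2 `KolyvaginPrimitiveAdditive` (KPA′, item stmt-BirchSwinnertonDyer-21400) BY NAME — the tree
theorem `AdditiveKoly.kolyvaginPrimitiveAdditive_of_indexLowerBound` (p619900; converse and `iff` p620657). So this line, like
`additive_fibre_ignition` (its `kolyvaginPrimitiveAdditive_of_stubs`), reaches r2 without S3/S4; what S3 + S4 add is KS′ itself.
[cite: McCallumLMS1991, §5 Cor. 5.6 (p. 310)] [cite: JetchevSkinnerWan2017, §7.4.1] -/
theorem kolyvaginPrimitiveAdditive_of_stubs
    (hMc : McCallum1991_padicValNat_card_sha_primary_add_le_of_globalDivisibility) :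
    Summit.BirchSwinnertonDyer.BirchSwinnertonDyer.Theses.AdditiveKolyvaginRoad.KolyvaginPrimitiveAdditive :=
  kolyvaginPrimitiveAdditive_of_indexLowerBound stub_publishedInputs hMc
    (stub_indexLowerBoundAdditive stub_publishedInputs stub_publishedDuality)

end Summit.BirchSwinnertonDyer.BirchSwinnertonDyer.Cruxes.LevelKolyvaginSystemsAdditive.BdpRebase

end
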